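import Summits.NavierStokesRegularity.FunctionalMining.StrainMomentRateSup
import HarnessLib

/-!
# FunctionalMining — the regularised strain weight `(|S|² + ε)^{q/2}`: Kato bound and viscous sign

Search for candidate a priori estimates; no regularity claim. Cell `pub-nsfunc`, prove seat (gen 13). First of three
files proving the dictionary's typed node `StrainMomentCZClosure` (NOGO N8 = K0-FLAGS A5: for every
real `1 < q` there is `C` with `StrainMomentRateSupBound q C`) at `d = Fin 3` — the companion
`StrainMomentRateSup` did `q > 2` through the exact `∫|S|^q` balance; for `1 < q < 2` the weight
`s ↦ s^{q/2}` is singular at `S = 0`, so the rows are reached through the REGULARISED moments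
`F_ε = ∫ (|S|² + ε)^{q/2}`, `ε > 0`. This file supplies the pointwise and static inputs:

* `contDiffOn_rpow_add`, `deriv_rpow_add`, `deriv_deriv_rpow_add` — calculus of
  `Ψ_ε(y) = (y + ε)^r` on `(−ε, ∞)`;
* `sum_partialDeriv_strainSqAt_sq_le` — the Kato-type bound `∑ₖ(∂ₖ|S|²)² ≤ 4|S|²∑ₖ∑ᵢⱼ(∂ₖSᵢⱼ)²`
  (`∂ₖ|S|² = 2∑ᵢⱼSᵢⱼ∂ₖSᵢⱼ`, Cauchy–Schwarz);
* `viscous_reg_nonpos` — for smooth `v`, `ε > 0`, real `q ≥ 1`: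
  `∫ Ψ_ε'(|S|²)∑ᵢⱼSᵢⱼ(∂ᵢΔv)ⱼ ≤ 0`. By parts (tree
  `GradientTensor.integral_deriv_comp_strainSqAt_mul_sum_strain_laplacian`) the term is
  `−∫Ψ_ε'|∇S|² − ½∫Ψ_ε''∑ₖ(∂ₖ|S|²)²`; for `q ≥ 2` both pieces are `≤ 0`, for `1 ≤ q < 2` the Kato
  bound and `2|Ψ_ε''(y)|y ≤ (2 − q)Ψ_ε'(y)` give `≤ −(q−1)∫Ψ_ε'|∇S|² ≤ 0` (the `p`-Laplacian-type
  absorption; no sign is claimed for `q < 1`).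
-/

noncomputable section

open MeasureTheory Finset Set Filter Topology
open scoped InnerProductSpace RealInnerProductSpace ContDiff

namespace Summit.NavierStokesRegularity.FunctionalMining

open Literature.Analysis.FunctionSpaces Literature.Analysis.FunctionSpaces.Torus
  Literature.Analysis.FluidPDE

namespace StrainMoment

open StrainL4 VorticityL4

/-! ## 1. The regularised weight `Ψ_ε(y) = (y + ε)^{q/2}` -/

/-- `Ψ_ε` is smooth on `(−ε, ∞)`. [folklore] -/
theorem contDiffOn_rpow_add (ε r : ℝ) {n : WithTop ℕ∞} :
    ContDiffOn ℝ n (fun y : ℝ => (y + ε) ^ r) (Ioi (-ε)) := by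
  intro y hy
  have hy' : y + ε ≠ 0 := by
    have : -ε < y := hy
    intro h; linarith
  exact ((contDiffAt_id.add contDiffAt_const).rpow_const_of_ne hy').contDiffWithinAt

/-- `Ψ_ε'(y) = r (y + ε)^{r−1}` where `y + ε > 0`. [folklore] -/
theorem deriv_rpow_add {ε r y : ℝ} (hy : 0 < y + ε) :
    deriv (fun y : ℝ => (y + ε) ^ r) y = r * (y + ε) ^ (r - 1) := by
  have h := ((hasDerivAt_id' y).add_const ε).rpow_const (p := r) (Or.inl hy.ne')
  rw [h.deriv]; ring

/-- `Ψ_ε''(y) = r (r−1) (y + ε)^{r−2}` where `y + ε > 0`. [folklore] -/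
theorem deriv_deriv_rpow_add {ε r y : ℝ} (hy : 0 < y + ε) :
    deriv (deriv (fun y : ℝ => (y + ε) ^ r)) y = r * (r - 1) * (y + ε) ^ (r - 2) := by
  have hev : deriv (fun y : ℝ => (y + ε) ^ r) =ᶠ[𝓝 y] fun z => r * (z + ε) ^ (r - 1) := by
    have hmem : Ioi (-ε) ∈ 𝓝 y := Ioi_mem_nhds (by linarith)
    filter_upwards [hmem] with z hz
    exact deriv_rpow_add (by have : -ε < z := hz; linarith)
  rw [hev.deriv_eq]
  have h := (((hasDerivAt_id' y).add_const ε).rpow_const (p := r - 1) (Or.inl hy.ne')).const_mul r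
  rw [h.deriv]
  rw [show r - 1 - 1 = r - 2 by ring]
  ring

/-! ## 2. Kato-type bound `|∇|S|²|² ≤ 4|S|²|∇S|²` -/

/-- **`∑ₖ (∂ₖ|S|²)² ≤ 4 |S|² ∑ₖ∑ᵢⱼ (∂ₖSᵢⱼ)²`** pointwise, for smooth `v` on `T^d`
(`∂ₖ|S|² = 2∑ᵢⱼSᵢⱼ∂ₖSᵢⱼ` and Cauchy–Schwarz). [folklore] -/
theorem sum_partialDeriv_strainSqAt_sq_le {d : Type*} [Fintype d] [DecidableEq d]
    {v : UnitAddTorus d → EuclideanSpace ℝ d} (hv : IsSmooth v) (x : UnitAddTorus d) :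
    ∑ k, partialDeriv k (torusStrainSqAt v) x ^ 2 ≤
      4 * torusStrainSqAt v x * ∑ k, ∑ i, ∑ j,
        ((partialDeriv k (partialDeriv j v) x i + partialDeriv k (partialDeriv i v) x j) / 2) ^ 2 := by
  rw [Finset.mul_sum]
  refine Finset.sum_le_sum fun k _ => ?_
  -- `∂ₖ|S|² = 2 ∑ᵢⱼ Sᵢⱼ ∂ₖSᵢⱼ`
  set T : d → d → ℝ := fun i j => (partialDeriv j v x i + partialDeriv i v x j) / 2 with hT
  set B : d → d → ℝ := fun i j =>
    (partialDeriv k (partialDeriv j v) x i + partialDeriv k (partialDeriv i v) x j) / 2 with hB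
  have hTsymm : ∀ i j, T i j = T j i := fun i j => by simp only [hT]; ring
  have hD : partialDeriv k (torusStrainSqAt v) x = 2 * ∑ i, ∑ j, T i j * B i j := by
    rw [GradientTensor.partialDeriv_strainSqAt hv k x]
    congr 1
    have h := GradientTensor.sum_symm_mul_eq_sum_symm_mul_symmPart T
      (fun i j => partialDeriv k (partialDeriv i v) x j) hTsymm
    simpa only [hT, hB] using h
  have hQ : torusStrainSqAt v x = ∑ i, ∑ j, T i j ^ 2 := by
    simp only [torusStrainSqAt, hT]
  -- Cauchy–Schwarz over the double index
  have hCS : (∑ i, ∑ j, T i j * B i j) ^ 2 ≤ (∑ i, ∑ j, T i j ^ 2) * ∑ i, ∑ j, B i j ^ 2 := by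
    have h := Finset.sum_mul_sq_le_sq_mul_sq (Finset.univ : Finset (d × d))
      (fun p => T p.1 p.2) (fun p => B p.1 p.2)
    simpa only [Fintype.sum_prod_type] using h
  have hB2 : ∑ i, ∑ j, B i j ^ 2 = ∑ i, ∑ j,
      ((partialDeriv k (partialDeriv j v) x i + partialDeriv k (partialDeriv i v) x j) / 2) ^ 2 := by
    simp only [hB]
  rw [hD, hQ, ← hB2]
  nlinarith [hCS]

/-! ## 3. The viscous term of the regularised balance is nonpositive (`q ≥ 1`) -/

/-- **Viscous sign for the regularised weight.** For smooth `v` on `T^d`, `ε > 0` and real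
`q ≥ 1`: `∫ Ψ_ε'(|S|²) ∑ᵢⱼ Sᵢⱼ (∂ᵢΔv)ⱼ ≤ 0`, `Ψ_ε(y) = (y+ε)^{q/2}` — by parts
(`integral_deriv_comp_strainSqAt_mul_sum_strain_laplacian`) this is
`−∫Ψ_ε'|∇S|² − ½∫Ψ_ε''∑ₖ(∂ₖ|S|²)²`; for `q ≥ 2` both terms are nonpositive, for `1 ≤ q < 2` the
Kato-type bound and `2|Ψ_ε''(y)|y ≤ (2−q)Ψ_ε'(y)` absorb the second into the first. [ours] -/
theorem viscous_reg_nonpos {d : Type*} [Fintype d] [DecidableEq d]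
    {v : UnitAddTorus d → EuclideanSpace ℝ d} (hv : IsSmooth v) {ε q : ℝ} (hε : 0 < ε)
    (hq : 1 ≤ q) :
    ∫ x, deriv (fun y : ℝ => (y + ε) ^ (q / 2)) (torusStrainSqAt v x) * ∑ i, ∑ j,
        (partialDeriv j v x i + partialDeriv i v x j) / 2 *
          partialDeriv i (Torus.laplacian v) x j ≤ 0 := by
  have hQ0 : ∀ x, 0 ≤ torusStrainSqAt v x := torusStrainSqAt_nonneg v
  have hpos : ∀ x, 0 < torusStrainSqAt v x + ε := fun x => by linarith [hQ0 x]
  have hmaps : ∀ x, torusStrainSqAt v x ∈ Ioi (-ε) := fun x => by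
    show -ε < torusStrainSqAt v x; linarith [hQ0 x]
  have hid := GradientTensor.integral_deriv_comp_strainSqAt_mul_sum_strain_laplacian hv isOpen_Ioi
    (contDiffOn_rpow_add ε (q / 2)) hmaps
  rw [hid]
  -- names
  set D2 : UnitAddTorus d → ℝ := fun x => ∑ k, ∑ i, ∑ j,
    ((partialDeriv k (partialDeriv j v) x i + partialDeriv k (partialDeriv i v) x j) / 2) ^ 2 with hD2
  set KK : UnitAddTorus d → ℝ := fun x => ∑ k, partialDeriv k (torusStrainSqAt v) x ^ 2 with hKK
  have hD20 : ∀ x, 0 ≤ D2 x := fun x => Finset.sum_nonneg fun k _ => Finset.sum_nonneg fun i _ =>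
    Finset.sum_nonneg fun j _ => sq_nonneg _
  have hKK0 : ∀ x, 0 ≤ KK x := fun x => Finset.sum_nonneg fun k _ => sq_nonneg _
  have hKato : ∀ x, KK x ≤ 4 * torusStrainSqAt v x * D2 x := fun x =>
    sum_partialDeriv_strainSqAt_sq_le hv x
  -- the two weights, pointwise
  have hw1 : ∀ x, deriv (fun y : ℝ => (y + ε) ^ (q / 2)) (torusStrainSqAt v x) =
      q / 2 * (torusStrainSqAt v x + ε) ^ (q / 2 - 1) := fun x => deriv_rpow_add (hpos x)
  have hw2 : ∀ x, deriv (deriv (fun y : ℝ => (y + ε) ^ (q / 2))) (torusStrainSqAt v x) =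
      q / 2 * (q / 2 - 1) * (torusStrainSqAt v x + ε) ^ (q / 2 - 2) := fun x =>
    deriv_deriv_rpow_add (hpos x)
  -- pointwise: `−½ Ψ'' K ≤ Ψ' D2`
  have hpt : ∀ x, -(2⁻¹ * (deriv (deriv (fun y : ℝ => (y + ε) ^ (q / 2))) (torusStrainSqAt v x) *
      KK x)) ≤ deriv (fun y : ℝ => (y + ε) ^ (q / 2)) (torusStrainSqAt v x) * D2 x := by
    intro x
    rw [hw1 x, hw2 x]
    set y := torusStrainSqAt v x with hy
    have hy0 : 0 ≤ y := hQ0 x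
    have hyε : 0 < y + ε := hpos x
    have hA : 0 ≤ (y + ε) ^ (q / 2 - 1) := Real.rpow_nonneg hyε.le _
    have hA2 : 0 ≤ (y + ε) ^ (q / 2 - 2) := Real.rpow_nonneg hyε.le _
    have hrhs : 0 ≤ q / 2 * (y + ε) ^ (q / 2 - 1) * D2 x :=
      mul_nonneg (mul_nonneg (by linarith) hA) (hD20 x)
    rcases le_or_gt 2 q with hq2 | hq2
    · -- `q ≥ 2`: `Ψ'' ≥ 0`
      have h1 : 0 ≤ q / 2 * (q / 2 - 1) * (y + ε) ^ (q / 2 - 2) * KK x :=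
        mul_nonneg (mul_nonneg (mul_nonneg (by linarith) (by linarith)) hA2) (hKK0 x)
      linarith
    · -- `1 ≤ q < 2`: Kato and `2|Ψ''| y ≤ (2 - q) Ψ'`
      have hsplit : (y + ε) ^ (q / 2 - 1) = (y + ε) ^ (q / 2 - 2) * (y + ε) := by
        rw [show q / 2 - 1 = (q / 2 - 2) + 1 by ring, Real.rpow_add hyε, Real.rpow_one]
      have hc : 0 ≤ q / 2 * (1 - q / 2) := mul_nonneg (by linarith) (by linarith)
      -- `−½Ψ''K = ½ (q/2)(1−q/2)(y+ε)^{q/2−2} K ≤ ½ (q/2)(1−q/2)(y+ε)^{q/2−2} 4 y D2`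
      have h1 : -(2⁻¹ * (q / 2 * (q / 2 - 1) * (y + ε) ^ (q / 2 - 2) * KK x)) =
          2⁻¹ * (q / 2 * (1 - q / 2) * (y + ε) ^ (q / 2 - 2)) * KK x := by ring
      have h2 : 2⁻¹ * (q / 2 * (1 - q / 2) * (y + ε) ^ (q / 2 - 2)) * KK x ≤
          2⁻¹ * (q / 2 * (1 - q / 2) * (y + ε) ^ (q / 2 - 2)) * (4 * y * D2 x) :=
        mul_le_mul_of_nonneg_left (hKato x) (mul_nonneg (by norm_num) (mul_nonneg hc hA2))
      -- `y (y+ε)^{q/2−2} ≤ (y+ε)^{q/2−1}` and `q(1−q/2) = (2−q) q/2 ≤ q/2`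
      have h3 : 2⁻¹ * (q / 2 * (1 - q / 2) * (y + ε) ^ (q / 2 - 2)) * (4 * y * D2 x) ≤
          q / 2 * (y + ε) ^ (q / 2 - 1) * D2 x := by
        rw [hsplit]
        have h4 : y ≤ y + ε := by linarith
        have h5 : 2⁻¹ * (q / 2 * (1 - q / 2) * (y + ε) ^ (q / 2 - 2)) * (4 * y * D2 x) =
            (2 - q) * (q / 2 * ((y + ε) ^ (q / 2 - 2) * y) * D2 x) := by ring
        rw [h5]
        have h6 : q / 2 * ((y + ε) ^ (q / 2 - 2) * y) * D2 x ≤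
            q / 2 * ((y + ε) ^ (q / 2 - 2) * (y + ε)) * D2 x :=
          mul_le_mul_of_nonneg_right (mul_le_mul_of_nonneg_left
            (mul_le_mul_of_nonneg_left h4 hA2) (by linarith)) (hD20 x)
        have h7 : 0 ≤ q / 2 * ((y + ε) ^ (q / 2 - 2) * (y + ε)) * D2 x :=
          mul_nonneg (mul_nonneg (by linarith) (mul_nonneg hA2 hyε.le)) (hD20 x)
        have h8 : (2 - q) ≤ 1 := by linarith
        calc (2 - q) * (q / 2 * ((y + ε) ^ (q / 2 - 2) * y) * D2 x)
            ≤ (2 - q) * (q / 2 * ((y + ε) ^ (q / 2 - 2) * (y + ε)) * D2 x) :=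
              mul_le_mul_of_nonneg_left h6 (by linarith)
          _ ≤ 1 * (q / 2 * ((y + ε) ^ (q / 2 - 2) * (y + ε)) * D2 x) :=
              mul_le_mul_of_nonneg_right h8 h7
          _ = q / 2 * ((y + ε) ^ (q / 2 - 2) * (y + ε)) * D2 x := one_mul _
      linarith
  -- integrate
  have hQc : Continuous (torusStrainSqAt v) := continuous_strainSqAt hv
  have hcA : Continuous fun x => deriv (fun y : ℝ => (y + ε) ^ (q / 2)) (torusStrainSqAt v x) * D2 x := by
    have e : (fun x => deriv (fun y : ℝ => (y + ε) ^ (q / 2)) (torusStrainSqAt v x) * D2 x) =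
        fun x => q / 2 * (torusStrainSqAt v x + ε) ^ (q / 2 - 1) * D2 x := funext fun x => by rw [hw1 x]
    rw [e]
    refine (continuous_const.mul ((hQc.add continuous_const).rpow_const fun x =>
      Or.inl (hpos x).ne')).mul ?_
    exact continuous_finsetSum _ fun k _ => continuous_finsetSum _ fun i _ =>
      continuous_finsetSum _ fun j _ =>
        (((((hv.partialDeriv j).partialDeriv k).apply i).add
          (((hv.partialDeriv i).partialDeriv k).apply j)).continuous.div_const _).pow 2
  have hcB : Continuous fun x => deriv (deriv (fun y : ℝ => (y + ε) ^ (q / 2)))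
      (torusStrainSqAt v x) * KK x := by
    have e : (fun x => deriv (deriv (fun y : ℝ => (y + ε) ^ (q / 2))) (torusStrainSqAt v x) * KK x) =
        fun x => q / 2 * (q / 2 - 1) * (torusStrainSqAt v x + ε) ^ (q / 2 - 2) * KK x :=
      funext fun x => by rw [hw2 x]
    rw [e]
    refine (continuous_const.mul ((hQc.add continuous_const).rpow_const fun x =>
      Or.inl (hpos x).ne')).mul ?_
    exact continuous_finsetSum _ fun k _ => ((GradientTensor.isSmooth_strainSqAt hv).partialDeriv k).continuous.pow 2
  have hle : ∫ x, -(2⁻¹ * (deriv (deriv (fun y : ℝ => (y + ε) ^ (q / 2))) (torusStrainSqAt v x) *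
      KK x)) ≤ ∫ x, deriv (fun y : ℝ => (y + ε) ^ (q / 2)) (torusStrainSqAt v x) * D2 x :=
    integral_mono ((hcB.const_mul _).neg).integrable_unitAddTorus hcA.integrable_unitAddTorus
      fun x => hpt x
  rw [integral_neg, integral_const_mul] at hle
  simp only [hD2, hKK] at hle
  linarith

end StrainMoment

end Summit.NavierStokesRegularity.FunctionalMining

end
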